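import Summits.QuantumFields.YangMills.Theorems.FlatTubeReductionBOProjectionAdapted
import Summits.QuantumFields.YangMills.Theorems.FlatTubeReductionDressedSlowRate
import HarnessLib

/-!
# Fibrewise NORMALISATION of a Born–Oppenheimer profile by a slow scalar: `Ω̃(u,x) = n(u)·Ω(u,x)` — the (B-N) brick of «ratepack-v3» made exact for frozen profiles
# (route `FlatTubeReduction`, crux K1 `NearFlatRatioLaw` stmt-QuantumFields-24720; seat `ym-line-ftr-p1` g12; R2b1 RECORD rung — no summit statement is proved here)

WHY (memo `Cruxes/NearFlatRatioLaw/Lines/ratepack-v3-frozen-g12.md` §5 (N)): for a literally FROZEN fibre profile the fibre mass `fibreMassAd L w Ω u` varies with the slow point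
like `1 + O(orbitDist(u)²)` (the Faddeev–Popov factor in the soft weight), which is `O(λ_b)` — not `O(λ_b²)` — at the edge of the `β^{-1/6}` window; the hand-off object
(`AnalyticRatePotInput.hN`) wants `κ = O(λ_b²)`.  Multiplying the profile by the gauge-invariant slow scalar `n(u) = √(γ/mass(u))` makes the fibre mass EXACTLY `γ`, and every
other brick for `Ω̃` reduces to the frozen one with the amplitude `φ·n` (and dressing `n·W`):
* `boFunAd_scale` — `boFunAd φ (n•Ω) = boFunAd (φ·n) Ω`;  `fibreInnerAd_scale` — `⟨f, n•Ω⟩_u = n(u)·⟨f, Ω⟩_u` (so fibrewise orthogonality is unchanged where `n ≠ 0`);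
  `fibreMassAd_scale` — `mass(n•Ω)(u) = n(u)²·mass(Ω)(u)`;
* `scaledProfile_props` — measurability, `|Ω̃| ≤ 1` (for `|n| ≤ 1`), colour equivariance (for gauge-invariant `n`), support radius;
* ★ `fibreMassAd_normalise` — with `n(u) = √(γ/mass(u))` and `0 < γ ≤ mass(u)`: `mass(Ω̃)(u) = γ` and `0 ≤ n ≤ 1`.
HONEST FRAMING: bookkeeping; femto rung R2b1 (RECORD label); not infinite volume, not a gap, not Clay.  No defs, no named facts, no `sorry`.
-/

set_option autoImplicit false

noncomputable section

open MeasureTheory Filter Topology Real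
open scoped BigOperators
open Literature.MathematicalPhysics.QuantumFieldTheory
open Literature.MathematicalPhysics.QuantumLattice

namespace Summit.QuantumFields.YangMills.Theorems.FemtoTransferGap.RateTube

open Summit.QuantumFields.YangMills.Theorems.FemtoTransferGap
open Summit.QuantumFields.YangMills.Theorems.FemtoTransferGap.TwoLattice.ConstTube
open Summit.QuantumFields.YangMills.Theorems.FemtoTransferGap.TwoLattice.Stiff (LinkSpace)

variable {L : ℕ} [NeZero L]

/-! ## §1 Algebra of a slow scalar factor -/

/-- `boFunAd φ (n•Ω) = boFunAd (φ·n) Ω`. [folklore] -/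
theorem boFunAd_scale (φ n : GaugeConfig 3 1 SU2 → ℝ) (Ω : GaugeConfig 3 1 SU2 → LinkSpace L → ℝ) :
    boFunAd L φ (fun u x => n u * Ω u x) = boFunAd L (fun u => φ u * n u) Ω := by
  funext U
  unfold boFunAd
  ring

/-- `fibreInnerAd w (n•Ω) f u = n u · fibreInnerAd w Ω f u`. [folklore] -/
theorem fibreInnerAd_scale (w : GaugeConfig 3 L SU2 → ℝ) (n : GaugeConfig 3 1 SU2 → ℝ) (Ω : GaugeConfig 3 1 SU2 → LinkSpace L → ℝ) (f : GaugeConfig 3 L SU2 → ℝ)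
    (u : GaugeConfig 3 1 SU2) : fibreInnerAd L w (fun u x => n u * Ω u x) f u = n u * fibreInnerAd L w Ω f u := by
  unfold fibreInnerAd
  rw [← integral_const_mul]
  refine integral_congr_ae (ae_of_all _ fun v => ?_)
  dsimp only
  ring

/-- `fibreMassAd w (n•Ω) u = (n u)² · fibreMassAd w Ω u`. [folklore] -/
theorem fibreMassAd_scale (w : GaugeConfig 3 L SU2 → ℝ) (n : GaugeConfig 3 1 SU2 → ℝ) (Ω : GaugeConfig 3 1 SU2 → LinkSpace L → ℝ) (u : GaugeConfig 3 1 SU2) :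
    fibreMassAd L w (fun u x => n u * Ω u x) u = n u ^ 2 * fibreMassAd L w Ω u := by
  unfold fibreMassAd
  rw [← integral_const_mul]
  refine integral_congr_ae (ae_of_all _ fun v => ?_)
  dsimp only
  ring

/-- Fibrewise orthogonality is unchanged by a slow scalar: `fibreInnerAd w Ω f u = 0 → fibreInnerAd w (n•Ω) f u = 0`. [folklore] -/
theorem fibreInnerAd_scale_eq_zero {w : GaugeConfig 3 L SU2 → ℝ} (n : GaugeConfig 3 1 SU2 → ℝ) {Ω : GaugeConfig 3 1 SU2 → LinkSpace L → ℝ} {f : GaugeConfig 3 L SU2 → ℝ}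
    {u : GaugeConfig 3 1 SU2} (h : fibreInnerAd L w Ω f u = 0) : fibreInnerAd L w (fun u x => n u * Ω u x) f u = 0 := by
  rw [fibreInnerAd_scale, h, mul_zero]

/-! ## §2 The scaled profile inherits the structural properties -/

/-- ★ **Structural fields of the scaled profile**: for jointly measurable `Ω` with `|Ω| ≤ 1`, colour-equivariant, supported in `‖x‖ ≤ r`, and a measurable gauge-invariant slow scalar
`n` with `|n| ≤ 1`: the profile `Ω̃(u,x) = n(u)Ω(u,x)` is jointly measurable, `|Ω̃| ≤ 1`, colour-equivariant and supported in `‖x‖ ≤ r`. [folklore] -/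
theorem scaledProfile_props {Ω : GaugeConfig 3 1 SU2 → LinkSpace L → ℝ} (hΩm : Measurable (Function.uncurry Ω)) (hΩ1 : ∀ u x, |Ω u x| ≤ 1)
    (hΩinv : ∀ (g : SU2) (u : GaugeConfig 3 1 SU2) (v : LinkSpace L), Ω (gaugeTransform (fun _ : Site 3 1 => g) u) (adL L g v) = Ω u v)
    {r : ℝ} (hΩr : ∀ u x, Ω u x ≠ 0 → ‖x‖ ≤ r)
    {n : GaugeConfig 3 1 SU2 → ℝ} (hnm : Measurable n) (hn1 : ∀ u, |n u| ≤ 1) (hninv : ∀ (g : SU2) (u : GaugeConfig 3 1 SU2), n (gaugeTransform (fun _ : Site 3 1 => g) u) = n u) :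
    Measurable (Function.uncurry fun u x => n u * Ω u x) ∧ (∀ u x, |n u * Ω u x| ≤ 1) ∧
      (∀ (g : SU2) (u : GaugeConfig 3 1 SU2) (v : LinkSpace L), n (gaugeTransform (fun _ : Site 3 1 => g) u) * Ω (gaugeTransform (fun _ : Site 3 1 => g) u) (adL L g v) = n u * Ω u v) ∧
      ∀ u x, n u * Ω u x ≠ 0 → ‖x‖ ≤ r := by
  refine ⟨(hnm.comp measurable_fst).mul hΩm, fun u x => ?_, fun g u v => by rw [hninv, hΩinv], fun u x h => hΩr u x (right_ne_zero_of_mul h)⟩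
  rw [abs_mul]
  calc |n u| * |Ω u x| ≤ 1 * 1 := mul_le_mul (hn1 u) (hΩ1 u x) (abs_nonneg _) zero_le_one
    _ = 1 := one_mul 1

/-! ## §3 ★ Normalisation to an exact fibre mass -/

/-- ★ **Exact fibre mass after normalisation.**  If `0 < γ ≤ fibreMassAd w Ω u` then with `n u = √(γ / fibreMassAd w Ω u)`: `fibreMassAd w (n•Ω) u = γ`, `0 ≤ n u ≤ 1`.
(Apply on the slow window, where (B-N) provides the two-sided mass; off the window set `n = 0` or `1` as convenient.) [folklore] -/
theorem fibreMassAd_normalise {w : GaugeConfig 3 L SU2 → ℝ} {Ω : GaugeConfig 3 1 SU2 → LinkSpace L → ℝ} {γ : ℝ} (hγ : 0 < γ) {u : GaugeConfig 3 1 SU2}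
    (hm : γ ≤ fibreMassAd L w Ω u) {n : GaugeConfig 3 1 SU2 → ℝ} (hn : n u = Real.sqrt (γ / fibreMassAd L w Ω u)) :
    fibreMassAd L w (fun u x => n u * Ω u x) u = γ ∧ 0 ≤ n u ∧ n u ≤ 1 := by
  have hm0 : 0 < fibreMassAd L w Ω u := lt_of_lt_of_le hγ hm
  have hq0 : 0 ≤ γ / fibreMassAd L w Ω u := div_nonneg hγ.le hm0.le
  have hq1 : γ / fibreMassAd L w Ω u ≤ 1 := (div_le_one hm0).mpr hm
  refine ⟨?_, by rw [hn]; exact Real.sqrt_nonneg _, by rw [hn]; exact Real.sqrt_le_one.mpr hq1 |>.trans le_rfl⟩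
  rw [fibreMassAd_scale, hn, Real.sq_sqrt hq0, div_mul_cancel₀ γ hm0.ne']

/-- ★ **The two-sidedness of the normalising scalar**: if `|mass(u) − γ₀| ≤ η·γ₀` with `0 ≤ η < 1` and `γ = γ₀(1 − η)`, then `γ ≤ mass(u)` and
`n(u)² = γ/mass(u) ∈ [(1−η)/(1+η), 1]`, so `|n(u)² − 1| ≤ 2η/(1+η) ≤ 2η` — the normalisation is a two-sided dressing of size `η` (for frozen profiles `η = O(orbitDist²)`,
absorbed into `W`). [folklore] -/
theorem normaliser_sq_two_sided {m γ₀ η : ℝ} (hγ₀ : 0 < γ₀) (hη0 : 0 ≤ η) (hη1 : η < 1) (hm : |m - γ₀| ≤ η * γ₀) :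
    γ₀ * (1 - η) ≤ m ∧ |γ₀ * (1 - η) / m - 1| ≤ 2 * η := by
  obtain ⟨h1, h2⟩ := abs_le.mp hm
  have hml : γ₀ * (1 - η) ≤ m := by linarith
  have hmpos : 0 < m := lt_of_lt_of_le (by nlinarith) hml
  refine ⟨hml, abs_le.mpr ⟨?_, ?_⟩⟩
  · -- `γ₀(1−η)/m ≥ (1−η)/(1+η) ≥ 1 − 2η`
    have hmu : m ≤ γ₀ * (1 + η) := by linarith
    have h3 : γ₀ * (1 - η) / m ≥ γ₀ * (1 - η) / (γ₀ * (1 + η)) :=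
      div_le_div_of_nonneg_left (by nlinarith) hmpos hmu
    have h4 : γ₀ * (1 - η) / (γ₀ * (1 + η)) = (1 - η) / (1 + η) := by
      rw [mul_div_mul_left _ _ hγ₀.ne']
    have h5 : (1 - η) / (1 + η) ≥ 1 - 2 * η := by
      rw [ge_iff_le, le_div_iff₀ (by linarith)]; nlinarith
    linarith [h3, h4, h5]
  · have : γ₀ * (1 - η) / m ≤ 1 := (div_le_one hmpos).mpr hml
    linarith

end Summit.QuantumFields.YangMills.Theorems.FemtoTransferGap.RateTube

end
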